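import Literature.AlgebraicGeometry.HodgeTheory.HodgeConjectureProductsCubicFivefoldsOfELV
import Literature.AlgebraicGeometry.HodgeTheory.MaxRationalSubHodgeStructureKunnethThreefoldFactors
import Literature.AlgebraicGeometry.HodgeTheory.MaxRationalSubHodgeStructureKunnethSymmetric
import Literature.AlgebraicGeometry.HodgeTheory.GeneralHodgePropertyKnownCases
import HarnessLib

/-!
# `HC(X)` and `HC(Y × Z)` from SMALL CHOW GROUPS: `CH₀, …, CH_{k₀}` of rank `≤ 1` up to `dim = 2k₀ + 5` for one variety, `dim Y + dim Z ≤ 2(k₀ + k₁) + 7` for a product — fivefolds with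
# `CH₀ = CH₁ = ℚ` times curves, surfaces, threefolds, fourfolds and fivefolds; cubic fivefolds granted Esnault–Levine–Viehweg
# (Laterveer 1998 / Paranjape 1994; Vial 2013 Thm. 7.1 (i); Voisin II Thm. 10.29, Thm. 10.31; Voisin 2013 Lemma 2.1; Voisin I §11.3.3; Bloch–Srinivas 1983; ELV 1997 Thm. 4.6)

Family `hodge`, lane `lit-hodgefound` (Track 2 foundations library; Layers A1/A4), layer `Literature/AlgebraicGeometry/HodgeTheory`.  THEOREMS ONLY (no definition, no named fact, no instance;
D-0026 net debt `0`).  Sequel of the seat's coniveau product criteria (g33-#3 – g33-#6: `BettiHodgeConjectureProductOfThreefoldsConiveauOrHodgeNumbers`, `BettiHodgeConjectureFourfoldProductsConiveau`,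
`BettiHodgeConjectureCurveOrSurfaceTimesConiveauThreefold`, `BettiHodgeConjectureProductOfFourfoldsConiveau`, all fed by Bloch–Srinivas `N¹` on `CH₀`-small factors) and of the tree's
`SupportedClassesOfSmallChowGroups` (PROVED: `Motives.ChowRankLEOneUpTo X k₀` ⟹ `N^{k₀+1} Hᵏ(X) = Hᵏ(X)` for `k ≥ 2k₀ + 1`, the generalised decomposition of the diagonal),
`HodgeConjectureProductsThreefoldsSmallChowZero` (`HC(T × T')`, `CH₀` of rank `≤ 1` on two threefolds) and `HodgeConjectureProductsCubicFivefoldsOfELV` (`HC(Y × Y')` for two cubic fivefolds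
granted ELV).  Here the coniveau bookkeeping is done ONCE, in every dimension and for every level `k₀`.

THE ARGUMENT.  (1) ONE VARIETY (Laterveer; Vial 2013 Thm. 7.1 (i), whose hypothesis `i ≤ ⌊(d − 4)/2⌋` is exactly `d ≤ 2k₀ + 5`).  `HC(X)` is equivalent to `GHC(X, 2p, p)` for `2p ≤ dim X`
(hard Lefschetz, the tree's `hodgeConjectureFor_iff_forall_generalHodgePropertyFor_two_mul_le`); `p ≤ 1` is Lefschetz `(1,1)`; for `2 ≤ p`, `2p ≤ n ≤ 2k₀ + 5` gives `p − 2 ≤ k₀`, so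
`CH₀, …, CH_{p−2}` have rank `≤ 1` and `N^{p−1} H^{2p}(X) = H^{2p}(X)` (`2(p − 2) + 1 ≤ 2p`), and rational Hodge classes of degree `2p` supported in codimension `p − 1` are algebraic (Voisin 2013
Lemma 2.1, the tree's `generalHodgePropertyFor_two_mul_of_supportedClasses_eq_top`).  The tree's `Vial2013_hodgeConjectureFor_of_chowGroups_rank_le_one_holds` is the same theorem with the
hypothesis on the Chow GROUPS of all base changes `X_L`; the present form takes the tree's cycle-level predicate `Motives.ChowRankLEOneUpTo X k₀` over `ℂ` itself and any level `k₀`.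
(2) PRODUCTS (Voisin I §11.3.3 + Voisin 2013 Lemma 2.1 on the tree's Betti carriers).  By the seat's hard-Lefschetz assembly `BettiUniverse.hodgeConjectureFor_tensor_of_kunneth_pieces_pos_le`,
`HC(Y × Z)` follows from `HC(Y)`, `HC(Z)` and the algebraicity of the Hodge classes of the Künneth pieces `Hⁱ(Y) ⊗ Hʲ(Z) ⊂ H^{2c}(Y × Z)` with `1 ≤ i ≤ dim Y`, `1 ≤ j ≤ dim Z`, `c ≥ 2`; if
`Hⁱ(Y) = N^{ρ(i)} Hⁱ(Y)` and `Hʲ(Z) = N^{σ(j)} Hʲ(Z)` the piece lies in `N^{ρ(i)+σ(j)} H^{2c}(Y × Z)` and its Hodge classes are algebraic as soon as `c ≤ ρ(i) + σ(j) + 1`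
(`BettiUniverse.ofRatClass_crossMap_mem_algebraicClasses_of_supportedClasses_eq_top`) — **the coniveau product criterion** `BettiUniverse.hodgeConjectureFor_tensor_of_forall_supportedClasses_eq_top`.
(3) With `ChowRankLEOneUpTo Y k₀`, `ChowRankLEOneUpTo Z k₁` take `ρ(i) = min(k₀, ⌊(i−1)/2⌋) + 1`, `σ(j) = min(k₁, ⌊(j−1)/2⌋) + 1`; the inequality `c ≤ ρ(i) + σ(j) + 1` holds on the whole window iff
`dim Y ≤ 2k₀ + 5`, `dim Z ≤ 2k₁ + 5`, `dim Y + dim Z ≤ 2(k₀ + k₁) + 7` (elementary; odd `i, j` have slack `2`, even ones slack `1`).  With no hypothesis on `Z` (`σ = 0`) the window closes iff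
`dim Z ≤ 3` and `dim Y + dim Z ≤ 2k₀ + 5`.

WHAT IS PROVED (`0` sorrys; every statement a theorem; the standing tensor facts and the real Hodge model are theorems of the tree, so §3–§5 are hypothesis-free).
* §1 `hodgeConjectureFor_of_chowRankLEOneUpTo` — `ChowRankLEOneUpTo X k₀`, `dim X ≤ 2k₀ + 5` ⟹ `HC(X)`; `hodgeConjectureFor_of_forall_chowGroup_rank_le_one` (Chow-group spelling).
* §2 `BettiUniverse.hodgeConjectureFor_tensor_of_forall_supportedClasses_eq_top` — the coniveau product criterion (any coniveau profiles `ρ, σ`).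
* §3 `hodgeConjectureFor_tensor_of_chowRankLEOneUpTo` — `HC(Y × Z)` for `ChowRankLEOneUpTo Y k₀`, `ChowRankLEOneUpTo Z k₁`, `dim Y ≤ 2k₀ + 5`, `dim Z ≤ 2k₁ + 5`, `dim Y + dim Z ≤ 2(k₀+k₁) + 7`;
  `hodgeConjectureFor_tensor_of_chowRankLEOneUpTo_of_dim_le_three` (+ mirror) — `HC(Y × Z)` for `ChowRankLEOneUpTo Y k₀`, ANY `Z` of dimension `≤ 3`, `dim Y + dim Z ≤ 2k₀ + 5`.
* §4 Instances: `HC(X₅ × C)`, `HC(X₅ × S)`, `HC(X₆ × C)` for five/sixfolds with `CH₀, CH₁` of rank `≤ 1` and ANY curve `C` / surface `S`; `HC(X₅ × T)`, `HC(X₆ × S)`, `HC(X₇ × C)` for `CH₀, CH₁, CH₂` of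
  rank `≤ 1` and ANY threefold `T`; `HC(X₅ × X₅')` for two fivefolds with `CH₀, CH₁` of rank `≤ 1` (the ELV-free form of the tree's cubic-fivefold theorem); `HC(X₅ × T)`, `HC(X₅ × F)`, `HC(X₆ × T)`
  for `CH₀, CH₁` of rank `≤ 1` on the big factor and `CH₀` of rank `≤ 1` on the threefold / fourfold.
* §5 Smooth cubic fivefolds `Y ⊂ ℙ⁶_ℂ` granted the tree's EXISTING named fact `Motives.EsnaultLevineViehweg1997_chowGroup_rank_le_one` (hypothesis `hELV`, as in
  `HodgeConjectureProductsCubicFivefoldsOfELV`): `HC(Y × C)`, `HC(Y × S)` for every curve / surface, `HC(Y × T)`, `HC(Y × F)` for threefolds / fourfolds with `CH₀` of rank `≤ 1`, `HC(Y × X₅)` for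
  fivefolds with `CH₀, CH₁` of rank `≤ 1`.

THE PRINTS.  R. Laterveer (1998) [Laterveer1998] main theorem; C. Vial (2013) [Vial2013] Thm. 7.1 (i) and its proof p. 19; C. Voisin (2003) [VoisinHodgeII2003] §10.3.1 Thm. 10.29, Thm. 10.31, §10.2.2
Thm. 10.17, Cor. 10.18; C. Voisin (2013) [Voisin2013GHCBloch] Lemma 2.1 (proof); C. Voisin (2002) [VoisinHodgeI2002] §11.3.3 Thm. 11.38–11.40, Lemma 11.41, pp. 285–287, §11.3.1 Thm. 11.30, §6.2.3
Thm. 6.25; S. Bloch, V. Srinivas (1983) [BlochSrinivas1983] Thm. 1; A. Grothendieck (1969) [GrothendieckTopology1969] §1, p. 300; H. Esnault, M. Levine, E. Viehweg (1997) [EsnaultLevineViehweg1997]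
Thm. 4.6; P. Deligne (2000/2006) [Deligne2000] §1.

THE OBJECTS (all the tree's).  `Motives.ChowRankLEOneUpTo`, `Motives.ChowGroup`, `supportedClasses`, `algebraicClasses`, `GeneralHodgePropertyFor`, `HodgeConjectureFor`, `BettiUniverse.kunnethSummand`,
`BettiUniverse.crossMap`, `hodgeClasses`, `ofRatClass`, `Motives.IsSmoothCompleteIntersection 5 (3)`, `Motives.EsnaultLevineViehweg1997_chowGroup_rank_le_one`; the tree's
`supportedClasses_eq_top_of_chowRankLEOneUpTo`, `hodgeConjectureFor_iff_forall_generalHodgePropertyFor_two_mul_le`, `generalHodgePropertyFor_two_mul_of_supportedClasses_eq_top`,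
`generalHodgePropertyFor_two_mul_self_of_lefschetzRange`, `BettiUniverse.hodgeConjectureFor_tensor_of_kunneth_pieces_pos_le`, `BettiUniverse.ofRatClass_crossMap_mem_algebraicClasses_of_supportedClasses_eq_top`,
`supportedClasses_zero`, `hodgeConjectureFor_of_dim_le_three_holds`, `chowRankLEOneUpTo_one_of_cubicFivefold_of_ELV`, `hodgeConjectureFor_tensor_comm_mp`, `hodgeTensorFacts_holds`,
`exists_isReal_hodgeModel_holds`, `IsSmoothProjective.tensor_holds`.

DEVIATIONS / SCOPE.  Complex orientations (through the tree's supported-classes and Künneth-piece lemmas).  `ChowRankLEOneUpTo` is the tree's cycle-level rank-`≤ 1` predicate over `ℂ` (the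
universal domain of the prints); no statement about other base fields.  §5 is conditional on the ELV fact exactly as the tree's `HodgeConjectureProductsCubicFivefoldsOfELV` (a refereed theorem whose
proof is not in the tree).  The numerical windows of §3 are sharp for the METHOD (outside them some Künneth piece is not forced into coniveau `c − 1` by the hypotheses), not claims about `HC`.

## References
* [Laterveer1998] R. Laterveer, *Algebraic varieties with small Chow groups*, J. Math. Kyoto Univ. 38 (1998) — main theorem (as quoted in Vial 2013 Thm. 7.1).
* [Vial2013] C. Vial, *Algebraic cycles and fibrations*, Doc. Math. 18 (2013) — Thm. 7.1 (i) and proof p. 19.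
* [VoisinHodgeII2003] C. Voisin, *Hodge Theory and Complex Algebraic Geometry II* — §10.3.1 Thm. 10.29, Thm. 10.31; §10.2.2 Thm. 10.17, Cor. 10.18; §9.2.4 Prop. 9.20.
* [Voisin2013GHCBloch] C. Voisin, Ann. Sci. ÉNS 46 (2013) — Lemma 2.1 (proof).
* [VoisinHodgeI2002] C. Voisin, *Hodge Theory and Complex Algebraic Geometry I* — §11.3.3 Thm. 11.38–11.40, Lemma 11.41, pp. 285–287; §11.3.1 Thm. 11.30; §6.2.3 Thm. 6.25.
* [BlochSrinivas1983] S. Bloch, V. Srinivas, Amer. J. Math. 105 (1983) — Thm. 1.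
* [GrothendieckTopology1969] A. Grothendieck, *Hodge's general conjecture is false for trivial reasons*, Topology 8 (1969) — §1, p. 300.
* [EsnaultLevineViehweg1997] H. Esnault, M. Levine, E. Viehweg, Duke Math. J. 87 (1997) — Thm. 4.6 (announced as Thm. 4.5 in the Introduction), first bullet.
* [Deligne2000] P. Deligne, *The Hodge conjecture* (Clay, 2000/2006) — §1.

## Provenance
Lane `lit-hodgefound` (summit `HodgeConjecture`, Track 2 foundations), seat `lit-hodgefound-p29` (literature-prover, generation 33, row g33-#7).
-/

noncomputable section

open scoped TensorProduct
open CategoryTheory AlgebraicGeometry MonoidalCategory CartesianMonoidalCategory Module Finset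
open Literature.AlgebraicTopology.SingularHomology
open Literature.Geometry.Kaehler

namespace Literature.AlgebraicGeometry.HodgeTheory

open Literature.AlgebraicGeometry.Motives
open Literature.AlgebraicGeometry.Motives.HodgeStructure

variable {m n d : ℕ} {X X' Y Z C S T F : SchemeOver ℂ}

/-! ### §1 `HC(X)` from small Chow groups (Laterveer; Vial 2013 Thm. 7.1 (i)), cycle-level form over `ℂ` -/

/-- **Laterveer 1998 / Vial 2013 Thm. 7.1 (i), on the tree's carriers and in the tree's cycle-level spelling: if `CH₀(X)_ℚ, …, CH_{k₀}(X)_ℚ` have rank `≤ 1` (`Motives.ChowRankLEOneUpTo X k₀`) and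
`dim X ≤ 2k₀ + 5` (i.e. `⌊(dim X − 4)/2⌋ ≤ k₀`), then `HC(X)`.**  Proof as printed: `HC(X) ⟺ GHC(X, 2p, p)` for `2p ≤ dim X` (hard Lefschetz); `p ≤ 1` is Lefschetz `(1,1)`; for `p ≥ 2`,
`CH₀, …, CH_{p−2}` of rank `≤ 1` give `N^{p−1} H^{2p}(X) = H^{2p}(X)` (generalised decomposition of the diagonal, the tree's PROVED `supportedClasses_eq_top_of_chowRankLEOneUpTo`), and rational
`(p,p)`-classes supported in codimension `p − 1` are algebraic.  (The tree's `Vial2013_hodgeConjectureFor_of_chowGroups_rank_le_one_holds` is the spelling with the Chow groups of all base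
changes `X_L`.) [cite: Vial2013, Thm 7.1 (i), proof p. 19] [cite: Laterveer1998, main theorem (as quoted in Vial2013 Thm. 7.1)] [cite: VoisinHodgeII2003, Thm. 10.29 and proof of Thm. 10.31]
[cite: Voisin2013GHCBloch, Lemma 2.1 (proof)] [cite: VoisinHodgeI2002, §11.3.1 Thm. 11.30 and §6.2.3 Thm. 6.25] -/
theorem hodgeConjectureFor_of_chowRankLEOneUpTo (hX : IsSmoothProjective n X) {k₀ : ℕ} (hCH : ChowRankLEOneUpTo X k₀) (hn : n ≤ 2 * k₀ + 5) :
    HodgeConjectureFor n X := by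
  refine (hodgeConjectureFor_iff_forall_generalHodgePropertyFor_two_mul_le hX).2 fun p hp ↦ ?_
  rcases Nat.lt_or_ge 1 p with hp1 | hp1
  swap
  · exact generalHodgePropertyFor_two_mul_self_of_lefschetzRange hX (Or.inl hp1)
  · have h := supportedClasses_eq_top_of_chowRankLEOneUpTo hX (hCH.mono (show p - 2 ≤ k₀ by omega)) (k := 2 * p) (by omega)
    rw [show p - 2 + 1 = p - 1 by omega] at h
    exact generalHodgePropertyFor_two_mul_of_supportedClasses_eq_top hX (p := p - 1) (by omega) h

/-- The same with the hypothesis on the Chow GROUPS `CH_j(X) = Z_j/Rat_j` (`Motives.ChowGroup`): **if for every `j ≤ k₀` any two classes of `CH_j(X)` are `ℤ`-linearly dependent and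
`dim X ≤ 2k₀ + 5`, then `HC(X)`.** [cite: Vial2013, Thm 7.1 (i)] [cite: Laterveer1998, main theorem (as quoted in Vial2013 Thm. 7.1)] [cite: VoisinHodgeII2003, Thm. 10.29 and proof of Thm. 10.31] -/
theorem hodgeConjectureFor_of_forall_chowGroup_rank_le_one (hX : IsSmoothProjective n X) {k₀ : ℕ}
    (hCH : ∀ j ≤ k₀, ∀ a b : ChowGroup X.left j, ∃ p q : ℤ, (p ≠ 0 ∨ q ≠ 0) ∧ p • a = q • b) (hn : n ≤ 2 * k₀ + 5) : HodgeConjectureFor n X :=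
  hodgeConjectureFor_of_chowRankLEOneUpTo hX ((chowRankLEOneUpTo_iff_chowGroup X k₀).2 hCH) hn

/-! ### §2 The coniveau product criterion -/

section Hodge

variable [HodgeTensorFacts.{0, 0}]

/-- **The coniveau product criterion.**  Let `Y`, `Z` be smooth projective of dimensions `m`, `n` with `HC(Y)`, `HC(Z)`, and suppose `Hⁱ(Y) = N^{ρ(i)} Hⁱ(Y)` for `1 ≤ i ≤ m` and
`Hʲ(Z) = N^{σ(j)} Hʲ(Z)` for `1 ≤ j ≤ n` (geometric coniveau profiles `ρ, σ`).  If `c ≤ ρ(i) + σ(j) + 1` whenever `i + j = 2c ≥ 4`, `1 ≤ i ≤ m`, `1 ≤ j ≤ n`, then `HC(Y × Z)`: by hard Lefschetz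
only these Künneth pieces matter, the piece `Hⁱ(Y) ⊗ Hʲ(Z)` lies in `N^{ρ(i)+σ(j)} H^{2c}(Y × Z) ⊆ N^{c−1}`, and rational `(c,c)`-classes of coniveau `c − 1` are algebraic (Voisin 2013 Lemma 2.1 on
the tree's carriers). [cite: Voisin2013GHCBloch, Lemma 2.1 (proof)] [cite: VoisinHodgeI2002, §11.3.3 Thm. 11.38–11.40, Lemma 11.41 and pp. 285–287, §6.2.3 Thm. 6.25] [cite: GrothendieckTopology1969, §1, p. 300]
[cite: Deligne2000, §1] -/
theorem BettiUniverse.hodgeConjectureFor_tensor_of_forall_supportedClasses_eq_top (hHD : exists_isReal_hodgeModel) (hY : IsSmoothProjective m Y) (hZ : IsSmoothProjective n Z)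
    (hYZ : IsSmoothProjective d (Y ⊗ Z)) (hHCY : HodgeConjectureFor m Y) (hHCZ : HodgeConjectureFor n Z) (ρ σ : ℕ → ℕ)
    (hYs : ∀ i, 1 ≤ i → i ≤ m → supportedClasses Y i (ρ i) = ⊤) (hZs : ∀ j, 1 ≤ j → j ≤ n → supportedClasses Z j (σ j) = ⊤)
    (hρσ : ∀ c i j : ℕ, i + j = 2 * c → 1 ≤ i → i ≤ m → 1 ≤ j → j ≤ n → 2 ≤ c → c ≤ ρ i + σ j + 1) : HodgeConjectureFor d (Y ⊗ Z) := by
  refine BettiUniverse.hodgeConjectureFor_tensor_of_kunneth_pieces_pos_le hHD hY hZ hYZ hHCY hHCZ fun c i j hij hi1 hi hj1 hj hc2 t ht ↦ ?_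
  obtain ⟨p, rfl⟩ : ∃ p, c = p + 1 := ⟨c - 1, by omega⟩
  have hp : p ≤ ρ i + σ j := by have := hρσ (p + 1) i j hij hi1 hi hj1 hj hc2; omega
  exact BettiUniverse.ofRatClass_crossMap_mem_algebraicClasses_of_supportedClasses_eq_top hHD hY hZ hYZ hij hp (hYs i hi1 hi) (hZs j hj1 hj) ht

end Hodge

/-! ### §3 Products of varieties with small Chow groups -/

/-- **`HC(Y × Z)` for smooth projective `Y`, `Z` with `CH₀, …, CH_{k₀}(Y)` and `CH₀, …, CH_{k₁}(Z)` of rank `≤ 1`, provided `dim Y ≤ 2k₀ + 5`, `dim Z ≤ 2k₁ + 5` and `dim Y + dim Z ≤ 2(k₀ + k₁) + 7`**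
— unconditionally.  The coniveau profiles are `ρ(i) = min(k₀, ⌊(i−1)/2⌋) + 1`, `σ(j) = min(k₁, ⌊(j−1)/2⌋) + 1` (generalised decomposition of the diagonal: `N^{k+1} Hⁱ = Hⁱ` for `2k + 1 ≤ i`,
`k ≤ k₀`), `HC(Y)`, `HC(Z)` are §1, and `c ≤ ρ(i) + σ(j) + 1` on the window `1 ≤ i ≤ dim Y`, `1 ≤ j ≤ dim Z`, `i + j = 2c` is the displayed arithmetic.  For `k₀ = k₁ = 0`, `m = n = 3` this is the
tree's `hodgeConjectureFor_tensor_threefolds_of_chowRankLEOneUpTo_zero`. [cite: VoisinHodgeII2003, Thm. 10.29 and proof of Thm. 10.31] [cite: Laterveer1998, main theorem (as quoted in Vial2013 Thm. 7.1)]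
[cite: Vial2013, Thm 7.1 (i)] [cite: Voisin2013GHCBloch, Lemma 2.1 (proof)] [cite: VoisinHodgeI2002, §11.3.3 Thm. 11.38, Lemma 11.41 and p. 287] [cite: Deligne2000, §1] -/
theorem hodgeConjectureFor_tensor_of_chowRankLEOneUpTo (hY : IsSmoothProjective m Y) (hZ : IsSmoothProjective n Z) {k₀ k₁ : ℕ} (hCHY : ChowRankLEOneUpTo Y k₀) (hCHZ : ChowRankLEOneUpTo Z k₁)
    (hm : m ≤ 2 * k₀ + 5) (hn : n ≤ 2 * k₁ + 5) (hmn : m + n ≤ 2 * (k₀ + k₁) + 7) : HodgeConjectureFor (m + n) (Y ⊗ Z) := by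
  haveI : HodgeTensorFacts.{0, 0} := hodgeTensorFacts_holds
  refine BettiUniverse.hodgeConjectureFor_tensor_of_forall_supportedClasses_eq_top exists_isReal_hodgeModel_holds hY hZ (hY.tensor_holds hZ)
    (hodgeConjectureFor_of_chowRankLEOneUpTo hY hCHY hm) (hodgeConjectureFor_of_chowRankLEOneUpTo hZ hCHZ hn) (fun i ↦ min k₀ ((i - 1) / 2) + 1)
    (fun j ↦ min k₁ ((j - 1) / 2) + 1) (fun i hi1 _ ↦ ?_) (fun j hj1 _ ↦ ?_) fun c i j hij hi1 hi hj1 hj hc2 ↦ ?_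
  · exact supportedClasses_eq_top_of_chowRankLEOneUpTo hY (hCHY.mono (min_le_left _ _)) (by omega)
  · exact supportedClasses_eq_top_of_chowRankLEOneUpTo hZ (hCHZ.mono (min_le_left _ _)) (by omega)
  · simp only [Nat.min_def]
    split_ifs <;> omega

/-- **`HC(Y × Z)` for `Y` with `CH₀, …, CH_{k₀}(Y)` of rank `≤ 1` and ANY smooth projective `Z` of dimension `≤ 3`, provided `dim Y + dim Z ≤ 2k₀ + 5`** — unconditionally (`HC(Z)` is the tree's
`hodgeConjectureFor_of_dim_le_three_holds`; profile `σ = 0`: the pieces `Hⁱ(Y) ⊗ Hʲ(Z)`, `j ≤ 3`, need `N^{c−1} Hⁱ(Y)` with `2c = i + j ≤ 2k₀ + 4`).  For `k₀ = 0` this covers `F × C`, `T × S`,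
`S' × T'` with `CH₀` of rank `≤ 1` on the first factor. [cite: VoisinHodgeII2003, Thm. 10.29 and proof of Thm. 10.31] [cite: Laterveer1998, main theorem (as quoted in Vial2013 Thm. 7.1)] [cite: Voisin2013GHCBloch, Lemma 2.1 (proof)]
[cite: VoisinHodgeI2002, §11.3.3 Thm. 11.38, Lemma 11.41 and p. 287, §11.3.1 Thm. 11.30] [cite: Deligne2000, §1] -/
theorem hodgeConjectureFor_tensor_of_chowRankLEOneUpTo_of_dim_le_three (hY : IsSmoothProjective m Y) (hZ : IsSmoothProjective n Z) {k₀ : ℕ} (hCHY : ChowRankLEOneUpTo Y k₀) (hn : n ≤ 3)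
    (hmn : m + n ≤ 2 * k₀ + 5) : HodgeConjectureFor (m + n) (Y ⊗ Z) := by
  haveI : HodgeTensorFacts.{0, 0} := hodgeTensorFacts_holds
  refine BettiUniverse.hodgeConjectureFor_tensor_of_forall_supportedClasses_eq_top exists_isReal_hodgeModel_holds hY hZ (hY.tensor_holds hZ)
    (hodgeConjectureFor_of_chowRankLEOneUpTo hY hCHY (by omega)) (hodgeConjectureFor_of_dim_le_three_holds hn hZ) (fun i ↦ min k₀ ((i - 1) / 2) + 1) (fun _ ↦ 0)
    (fun i hi1 _ ↦ ?_) (fun j _ _ ↦ supportedClasses_zero Z j) fun c i j hij hi1 hi hj1 hj hc2 ↦ ?_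
  · exact supportedClasses_eq_top_of_chowRankLEOneUpTo hY (hCHY.mono (min_le_left _ _)) (by omega)
  · simp only [Nat.min_def]
    split_ifs <;> omega

/-- Mirror: **`HC(Z × Y)`** for `Z` of dimension `≤ 3` and `Y` with `CH₀, …, CH_{k₀}` of rank `≤ 1`, `dim Y + dim Z ≤ 2k₀ + 5` (the tree's `hodgeConjectureFor_tensor_comm_mp`).
[cite: VoisinHodgeII2003, Thm. 10.29 and proof of Thm. 10.31] [cite: Voisin2013GHCBloch, Lemma 2.1 (proof)] [cite: Deligne2000, §1] -/
theorem hodgeConjectureFor_tensor_of_dim_le_three_of_chowRankLEOneUpTo (hZ : IsSmoothProjective n Z) (hY : IsSmoothProjective m Y) {k₀ : ℕ} (hCHY : ChowRankLEOneUpTo Y k₀) (hn : n ≤ 3)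
    (hmn : m + n ≤ 2 * k₀ + 5) : HodgeConjectureFor (n + m) (Z ⊗ Y) :=
  hodgeConjectureFor_tensor_comm_mp hY hZ (hodgeConjectureFor_tensor_of_chowRankLEOneUpTo_of_dim_le_three hY hZ hCHY hn hmn)

/-! ### §4 Instances in low dimension -/

/-- **`HC(X × C)` for every smooth projective FIVEFOLD `X` with `CH₀(X)_ℚ, CH₁(X)_ℚ` of rank `≤ 1` and every smooth projective curve `C`** (e.g. smooth cubic fivefolds, §5).
[cite: VoisinHodgeII2003, Thm. 10.29 and proof of Thm. 10.31] [cite: Voisin2013GHCBloch, Lemma 2.1 (proof)] [cite: VoisinHodgeI2002, §11.3.3 Thm. 11.38, Lemma 11.41 and p. 287] [cite: Deligne2000, §1] -/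
theorem hodgeConjectureFor_fivefold_tensor_curve_of_chowRankLEOneUpTo_one (hX : IsSmoothProjective 5 X) (hC : IsSmoothProjective 1 C) (hCH : ChowRankLEOneUpTo X 1) :
    HodgeConjectureFor (5 + 1) (X ⊗ C) :=
  hodgeConjectureFor_tensor_of_chowRankLEOneUpTo_of_dim_le_three hX hC hCH (by norm_num) (by norm_num)

/-- Mirror: **`HC(C × X)`**, `X` a fivefold with `CH₀, CH₁` of rank `≤ 1`, `C` any curve. [cite: VoisinHodgeII2003, Thm. 10.29 and proof of Thm. 10.31] [cite: Voisin2013GHCBloch, Lemma 2.1 (proof)] -/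
theorem hodgeConjectureFor_curve_tensor_fivefold_of_chowRankLEOneUpTo_one (hC : IsSmoothProjective 1 C) (hX : IsSmoothProjective 5 X) (hCH : ChowRankLEOneUpTo X 1) :
    HodgeConjectureFor (1 + 5) (C ⊗ X) :=
  hodgeConjectureFor_tensor_of_dim_le_three_of_chowRankLEOneUpTo hC hX hCH (by norm_num) (by norm_num)

/-- **`HC(X × S)` for every smooth projective FIVEFOLD `X` with `CH₀, CH₁` of rank `≤ 1` and every smooth projective SURFACE `S`** (no condition on `p_g(S)`: `h^{2,0}(X) = h^{4,0}(X) = h^{3,1}(X) = 0`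
in support form, `N¹H² = H²`, `N²H⁴ = H⁴`, `N²H⁵ = H⁵`, `N²H³ = H³`). [cite: VoisinHodgeII2003, Thm. 10.29 and proof of Thm. 10.31] [cite: Voisin2013GHCBloch, Lemma 2.1 (proof)]
[cite: VoisinHodgeI2002, §11.3.3 Thm. 11.38, Lemma 11.41 and p. 287] [cite: Deligne2000, §1] -/
theorem hodgeConjectureFor_fivefold_tensor_surface_of_chowRankLEOneUpTo_one (hX : IsSmoothProjective 5 X) (hS : IsSmoothProjective 2 S) (hCH : ChowRankLEOneUpTo X 1) :
    HodgeConjectureFor (5 + 2) (X ⊗ S) :=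
  hodgeConjectureFor_tensor_of_chowRankLEOneUpTo_of_dim_le_three hX hS hCH (by norm_num) (by norm_num)

/-- **`HC(X × C)` for every smooth projective SIXFOLD `X` with `CH₀, CH₁` of rank `≤ 1` and every curve `C`.** [cite: VoisinHodgeII2003, Thm. 10.29 and proof of Thm. 10.31] [cite: Voisin2013GHCBloch, Lemma 2.1 (proof)]
[cite: Deligne2000, §1] -/
theorem hodgeConjectureFor_sixfold_tensor_curve_of_chowRankLEOneUpTo_one (hX : IsSmoothProjective 6 X) (hC : IsSmoothProjective 1 C) (hCH : ChowRankLEOneUpTo X 1) :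
    HodgeConjectureFor (6 + 1) (X ⊗ C) :=
  hodgeConjectureFor_tensor_of_chowRankLEOneUpTo_of_dim_le_three hX hC hCH (by norm_num) (by norm_num)

/-- **`HC(X × T)` for every smooth projective FIVEFOLD `X` with `CH₀, CH₁, CH₂` of rank `≤ 1` and EVERY smooth projective threefold `T`.** [cite: VoisinHodgeII2003, Thm. 10.29 and proof of Thm. 10.31]
[cite: Voisin2013GHCBloch, Lemma 2.1 (proof)] [cite: VoisinHodgeI2002, §11.3.3 Thm. 11.38, Lemma 11.41 and p. 287] [cite: Deligne2000, §1] -/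
theorem hodgeConjectureFor_fivefold_tensor_threefold_of_chowRankLEOneUpTo_two (hX : IsSmoothProjective 5 X) (hT : IsSmoothProjective 3 T) (hCH : ChowRankLEOneUpTo X 2) :
    HodgeConjectureFor (5 + 3) (X ⊗ T) :=
  hodgeConjectureFor_tensor_of_chowRankLEOneUpTo_of_dim_le_three hX hT hCH (by norm_num) (by norm_num)

/-- **`HC(X × S)` for every smooth projective SIXFOLD `X` with `CH₀, CH₁, CH₂` of rank `≤ 1` and every surface `S`.** [cite: VoisinHodgeII2003, Thm. 10.29 and proof of Thm. 10.31] [cite: Voisin2013GHCBloch, Lemma 2.1 (proof)]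
[cite: Deligne2000, §1] -/
theorem hodgeConjectureFor_sixfold_tensor_surface_of_chowRankLEOneUpTo_two (hX : IsSmoothProjective 6 X) (hS : IsSmoothProjective 2 S) (hCH : ChowRankLEOneUpTo X 2) :
    HodgeConjectureFor (6 + 2) (X ⊗ S) :=
  hodgeConjectureFor_tensor_of_chowRankLEOneUpTo_of_dim_le_three hX hS hCH (by norm_num) (by norm_num)

/-- **`HC(X × C)` for every smooth projective SEVENFOLD `X` with `CH₀, CH₁, CH₂` of rank `≤ 1` and every curve `C`.** [cite: VoisinHodgeII2003, Thm. 10.29 and proof of Thm. 10.31] [cite: Voisin2013GHCBloch, Lemma 2.1 (proof)]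
[cite: Deligne2000, §1] -/
theorem hodgeConjectureFor_sevenfold_tensor_curve_of_chowRankLEOneUpTo_two (hX : IsSmoothProjective 7 X) (hC : IsSmoothProjective 1 C) (hCH : ChowRankLEOneUpTo X 2) :
    HodgeConjectureFor (7 + 1) (X ⊗ C) :=
  hodgeConjectureFor_tensor_of_chowRankLEOneUpTo_of_dim_le_three hX hC hCH (by norm_num) (by norm_num)

/-- **`HC(X × X')` for any two smooth projective FIVEFOLDS with `CH₀, CH₁` of rank `≤ 1`** — the hypersurface-free, ELV-free form of the tree's `hodgeConjectureFor_tensor_cubicFivefolds_of_ELV`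
(`N²H⁵ = H⁵`, `N²H⁴ = H⁴`, `N²H³ = H³`, `N¹H² = H²` on both factors). [cite: VoisinHodgeII2003, Thm. 10.29 and proof of Thm. 10.31] [cite: Laterveer1998, main theorem (as quoted in Vial2013 Thm. 7.1)]
[cite: Voisin2013GHCBloch, Lemma 2.1 (proof)] [cite: VoisinHodgeI2002, §11.3.3 Thm. 11.38, Lemma 11.41 and p. 287] [cite: Deligne2000, §1] -/
theorem hodgeConjectureFor_tensor_fivefolds_of_chowRankLEOneUpTo_one (hX : IsSmoothProjective 5 X) (hX' : IsSmoothProjective 5 X') (hCH : ChowRankLEOneUpTo X 1)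
    (hCH' : ChowRankLEOneUpTo X' 1) : HodgeConjectureFor (5 + 5) (X ⊗ X') :=
  hodgeConjectureFor_tensor_of_chowRankLEOneUpTo hX hX' hCH hCH' (by norm_num) (by norm_num) (by norm_num)

/-- **`HC(X × T)` for a smooth projective FIVEFOLD `X` with `CH₀, CH₁` of rank `≤ 1` and a smooth projective THREEFOLD `T` with `CH₀` of rank `≤ 1`** (e.g. `T` rationally connected).
[cite: VoisinHodgeII2003, Thm. 10.29, proof of Thm. 10.31 and §10.2.2 Thm. 10.17] [cite: BlochSrinivas1983, Thm. 1] [cite: Voisin2013GHCBloch, Lemma 2.1 (proof)] [cite: Deligne2000, §1] -/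
theorem hodgeConjectureFor_fivefold_tensor_threefold_of_chowRankLEOneUpTo_one_zero (hX : IsSmoothProjective 5 X) (hT : IsSmoothProjective 3 T) (hCH : ChowRankLEOneUpTo X 1)
    (hCHT : ChowRankLEOneUpTo T 0) : HodgeConjectureFor (5 + 3) (X ⊗ T) :=
  hodgeConjectureFor_tensor_of_chowRankLEOneUpTo hX hT hCH hCHT (by norm_num) (by norm_num) (by norm_num)

/-- Mirror: **`HC(T × X)`**, `CH₀(T)` of rank `≤ 1` on the threefold, `CH₀, CH₁` of rank `≤ 1` on the fivefold. [cite: VoisinHodgeII2003, Thm. 10.29 and proof of Thm. 10.31] [cite: BlochSrinivas1983, Thm. 1]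
[cite: Voisin2013GHCBloch, Lemma 2.1 (proof)] -/
theorem hodgeConjectureFor_threefold_tensor_fivefold_of_chowRankLEOneUpTo_zero_one (hT : IsSmoothProjective 3 T) (hX : IsSmoothProjective 5 X) (hCHT : ChowRankLEOneUpTo T 0)
    (hCH : ChowRankLEOneUpTo X 1) : HodgeConjectureFor (3 + 5) (T ⊗ X) :=
  hodgeConjectureFor_tensor_of_chowRankLEOneUpTo hT hX hCHT hCH (by norm_num) (by norm_num) (by norm_num)

/-- **`HC(X × F)` for a smooth projective FIVEFOLD `X` with `CH₀, CH₁` of rank `≤ 1` and a smooth projective FOURFOLD `F` with `CH₀` of rank `≤ 1`** (`h^{2,0}(F) = h^{4,0}(F) = 0`, `N¹H³(F) = H³(F)`,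
`N¹H⁴(F) = H⁴(F)` in support form). [cite: VoisinHodgeII2003, Thm. 10.29, proof of Thm. 10.31 and §10.2.2 Thm. 10.17] [cite: BlochSrinivas1983, Thm. 1] [cite: Voisin2013GHCBloch, Lemma 2.1 (proof)] [cite: Deligne2000, §1] -/
theorem hodgeConjectureFor_fivefold_tensor_fourfold_of_chowRankLEOneUpTo_one_zero (hX : IsSmoothProjective 5 X) (hF : IsSmoothProjective 4 F) (hCH : ChowRankLEOneUpTo X 1)
    (hCHF : ChowRankLEOneUpTo F 0) : HodgeConjectureFor (5 + 4) (X ⊗ F) :=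
  hodgeConjectureFor_tensor_of_chowRankLEOneUpTo hX hF hCH hCHF (by norm_num) (by norm_num) (by norm_num)

/-- **`HC(X × T)` for a smooth projective SIXFOLD `X` with `CH₀, CH₁` of rank `≤ 1` and a threefold `T` with `CH₀` of rank `≤ 1`.** [cite: VoisinHodgeII2003, Thm. 10.29, proof of Thm. 10.31 and §10.2.2 Thm. 10.17]
[cite: BlochSrinivas1983, Thm. 1] [cite: Voisin2013GHCBloch, Lemma 2.1 (proof)] [cite: Deligne2000, §1] -/
theorem hodgeConjectureFor_sixfold_tensor_threefold_of_chowRankLEOneUpTo_one_zero (hX : IsSmoothProjective 6 X) (hT : IsSmoothProjective 3 T) (hCH : ChowRankLEOneUpTo X 1)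
    (hCHT : ChowRankLEOneUpTo T 0) : HodgeConjectureFor (6 + 3) (X ⊗ T) :=
  hodgeConjectureFor_tensor_of_chowRankLEOneUpTo hX hT hCH hCHT (by norm_num) (by norm_num) (by norm_num)

/-! ### §5 Smooth cubic fivefolds, granted Esnault–Levine–Viehweg (`CH₀ = CH₁ = ℚ`) -/

/-- **`HC(Y × C)` for a smooth cubic fivefold `Y ⊂ ℙ⁶_ℂ` (smooth complete intersection of multidegree `(3)`) and EVERY smooth projective curve `C`, granted Esnault–Levine–Viehweg** (`l = 1`:
`C(4,2) = 6 ≤ 6`, the tree's `chowRankLEOneUpTo_one_of_cubicFivefold_of_ELV`). [cite: EsnaultLevineViehweg1997, Thm 4.6 (announced as Thm 4.5 in the Introduction), first bullet]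
[cite: VoisinHodgeII2003, Thm. 10.29 and proof of Thm. 10.31] [cite: Voisin2013GHCBloch, Lemma 2.1 (proof)] [cite: Deligne2000, §1] -/
theorem hodgeConjectureFor_cubicFivefold_tensor_curve_of_ELV (hELV : EsnaultLevineViehweg1997_chowGroup_rank_le_one.{0}) (hY : IsSmoothCompleteIntersection 5 (fun _ : Fin 1 => 3) Y)
    (hC : IsSmoothProjective 1 C) : HodgeConjectureFor (5 + 1) (Y ⊗ C) :=
  hodgeConjectureFor_fivefold_tensor_curve_of_chowRankLEOneUpTo_one hY.1 hC (chowRankLEOneUpTo_one_of_cubicFivefold_of_ELV hELV hY)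

/-- **`HC(Y × S)` for a smooth cubic fivefold `Y ⊂ ℙ⁶_ℂ` and EVERY smooth projective surface `S`, granted ELV.** [cite: EsnaultLevineViehweg1997, Thm 4.6 (announced as Thm 4.5 in the Introduction), first bullet]
[cite: VoisinHodgeII2003, Thm. 10.29 and proof of Thm. 10.31] [cite: Voisin2013GHCBloch, Lemma 2.1 (proof)] [cite: Deligne2000, §1] -/
theorem hodgeConjectureFor_cubicFivefold_tensor_surface_of_ELV (hELV : EsnaultLevineViehweg1997_chowGroup_rank_le_one.{0}) (hY : IsSmoothCompleteIntersection 5 (fun _ : Fin 1 => 3) Y)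
    (hS : IsSmoothProjective 2 S) : HodgeConjectureFor (5 + 2) (Y ⊗ S) :=
  hodgeConjectureFor_fivefold_tensor_surface_of_chowRankLEOneUpTo_one hY.1 hS (chowRankLEOneUpTo_one_of_cubicFivefold_of_ELV hELV hY)

/-- **`HC(Y × T)` for a smooth cubic fivefold `Y ⊂ ℙ⁶_ℂ` and a smooth projective threefold `T` with `CH₀(T)` of rank `≤ 1`, granted ELV.** [cite: EsnaultLevineViehweg1997, Thm 4.6 (announced as Thm 4.5 in the Introduction), first bullet]
[cite: VoisinHodgeII2003, Thm. 10.29, proof of Thm. 10.31 and §10.2.2 Thm. 10.17] [cite: BlochSrinivas1983, Thm. 1] [cite: Voisin2013GHCBloch, Lemma 2.1 (proof)] -/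
theorem hodgeConjectureFor_cubicFivefold_tensor_threefold_of_ELV_of_chowRankLEOneUpTo_zero (hELV : EsnaultLevineViehweg1997_chowGroup_rank_le_one.{0})
    (hY : IsSmoothCompleteIntersection 5 (fun _ : Fin 1 => 3) Y) (hT : IsSmoothProjective 3 T) (hCHT : ChowRankLEOneUpTo T 0) : HodgeConjectureFor (5 + 3) (Y ⊗ T) :=
  hodgeConjectureFor_fivefold_tensor_threefold_of_chowRankLEOneUpTo_one_zero hY.1 hT (chowRankLEOneUpTo_one_of_cubicFivefold_of_ELV hELV hY) hCHT

/-- **`HC(Y × F)` for a smooth cubic fivefold `Y ⊂ ℙ⁶_ℂ` and a smooth projective fourfold `F` with `CH₀(F)` of rank `≤ 1` (e.g. a smooth cubic fourfold), granted ELV.**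
[cite: EsnaultLevineViehweg1997, Thm 4.6 (announced as Thm 4.5 in the Introduction), first bullet] [cite: VoisinHodgeII2003, Thm. 10.29, proof of Thm. 10.31 and §10.2.2 Thm. 10.17] [cite: BlochSrinivas1983, Thm. 1]
[cite: Voisin2013GHCBloch, Lemma 2.1 (proof)] -/
theorem hodgeConjectureFor_cubicFivefold_tensor_fourfold_of_ELV_of_chowRankLEOneUpTo_zero (hELV : EsnaultLevineViehweg1997_chowGroup_rank_le_one.{0})
    (hY : IsSmoothCompleteIntersection 5 (fun _ : Fin 1 => 3) Y) (hF : IsSmoothProjective 4 F) (hCHF : ChowRankLEOneUpTo F 0) : HodgeConjectureFor (5 + 4) (Y ⊗ F) :=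
  hodgeConjectureFor_fivefold_tensor_fourfold_of_chowRankLEOneUpTo_one_zero hY.1 hF (chowRankLEOneUpTo_one_of_cubicFivefold_of_ELV hELV hY) hCHF

/-- **`HC(Y × X)` for a smooth cubic fivefold `Y ⊂ ℙ⁶_ℂ` and ANY smooth projective fivefold `X` with `CH₀, CH₁` of rank `≤ 1`, granted ELV** (for `X` a second cubic fivefold this is the tree's
`hodgeConjectureFor_tensor_cubicFivefolds_of_ELV`). [cite: EsnaultLevineViehweg1997, Thm 4.6 (announced as Thm 4.5 in the Introduction), first bullet] [cite: VoisinHodgeII2003, Thm. 10.29 and proof of Thm. 10.31]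
[cite: Voisin2013GHCBloch, Lemma 2.1 (proof)] [cite: VoisinHodgeI2002, §11.3.3 Thm. 11.38, Lemma 11.41 and p. 287] -/
theorem hodgeConjectureFor_cubicFivefold_tensor_fivefold_of_ELV_of_chowRankLEOneUpTo_one (hELV : EsnaultLevineViehweg1997_chowGroup_rank_le_one.{0})
    (hY : IsSmoothCompleteIntersection 5 (fun _ : Fin 1 => 3) Y) (hX : IsSmoothProjective 5 X) (hCH : ChowRankLEOneUpTo X 1) : HodgeConjectureFor (5 + 5) (Y ⊗ X) :=
  hodgeConjectureFor_tensor_fivefolds_of_chowRankLEOneUpTo_one hY.1 hX (chowRankLEOneUpTo_one_of_cubicFivefold_of_ELV hELV hY) hCH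

end Literature.AlgebraicGeometry.HodgeTheory

end
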